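import Summits.PneNP.PneNP.Theorems.ChebyshevTracialDesignDictionary
import Literature.Combinatorics.Optimization.PsdRankBasicProperties
import HarnessLib

/-!
# Cell pnp-psdrank, route `ChebyshevTracialDesign`: the dictionary lemma WITH A PSD REMAINDER — the junk of a directional decomposition is
# measured in trace, not in operator norm (crux `TracialDecayExp20`, stmt-PneNP-19878)

Brick 38 (prover g9). Brick 34 (`…Dictionary`) bounds the value of a tight psd rectangle whose cut side is EXACTLY dictionary-diagonal; MEMO-12 §2(b)(i)
records that operator-norm approximations by such strategies are useless because psd tightness cannot be repaired. The right notion of approximation is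
from BELOW in the Loewner order: if `X_U = D_U + E_U` with `D_U = Σ_d λ_U(d) v_d v_dᵀ` dictionary-diagonal (`0 ≤ λ ≤ 1`, `‖v_d‖ ≤ 1`, `|ι| = L` directions)
and a psd REMAINDER `E_U ⪰ 0`, then tightness `X_U Y_M = 0` splits into `tr(D_U Y_M) = 0` AND `E_U Y_M = 0` (a vanishing sum of two nonnegative traces;
the tree's `mul_eq_zero_of_posSemidef_trace_eq_zero`: psd `A, B` with `tr(AB) = 0` have `AB = 0`), so that

  `Σ W tr(X_U Y_M) ≤ L·γ + Σ W tr(E_U Y_M)`,   `(E, Y)` again a tight-orthogonal psd rectangle      (`value_le_dictionary_add_remainder`, `isPsdRect_of_le`),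

and the remainder is JUNK priced by its trace density: for a design weight, `value/r ≤ (L/r)·γ + (Σ_c|w_c|)·τ_E` with `τ_E = E_U tr E_U / r`
(`value_div_le_dictionary_add_remainder`; the tree's a priori bound `…APrioriBounds.value_div_le_variation_mul_min` on `(E, Y)`). Modulo KL Thm 1.8
(`GlobalLevelDInequality`, r = 1 rung): `value/r ≤ (L/r)·exp(−a·dq n) + 20·τ_E` for every balanced B = 20 design and every dimension
(`tracialDecayExp_dictionaryRemainder_of_globalLevelD`). This is the accounting a 'directional Kupavskii–Zakharov' step needs: pieces that are
dictionary-diagonal up to a Loewner-below remainder of small TRACE. [cite: Rothvoss2017, §2 (PDF pp. 6–8)] [cite: BrietDadushPokutta2014, Thm. 6 (§3)]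
[cite: KeevashLifshitz2023, Thm. 1.8]
Stature: support/instrument (§3 CONDITIONAL on `GlobalLevelDInequality`). WHAT THIS IS NOT: no decomposition theorem (which X admit such D with
small τ_E is the open directional-structure question), nothing on psd rank, no P-vs-NP content.
-/

set_option linter.dupNamespace false -- `Summit.PneNP.PneNP.…`: summit = sub-problem (D-0017)

noncomputable section

namespace Summit.PneNP.PneNP.Theorems.ChebyshevTracialDesignDictionaryRemainder

open scoped Classical

open Finset Matrix Literature.Barriers.PneNP Literature.Combinatorics.Optimization
open Literature.Combinatorics.Additive.KeevashLifshitz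
open Summit.PneNP.PneNP.Theorems.ChebyshevTracialDesignDimensionOne (tracialValueLEAt_one_iff)
open Summit.PneNP.PneNP.Theorems.ChebyshevTracialDesignDictionary
open Summit.PneNP.PneNP.Theorems.ChebyshevTracialDesignAPrioriBounds (value_div_le_variation_mul_min)
open Summit.PneNP.PneNP.Theorems.ChebyshevTracialDesignRungAssembly (rectangleDecayExp_of_globalLevelD)

variable {n : ℕ}

/-! ### §1 Loewner-below parts of a tight psd rectangle are tight psd rectangles -/

/-- **Sub-operators inherit tightness.** If `(X, Y)` is a tight-orthogonal psd rectangle and `0 ⪯ E_U ⪯ X_U` for every `U` (`E_U`, `X_U − E_U` psd), then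
`(E, Y)` is a tight-orthogonal psd rectangle. [cite: BrietDadushPokutta2014, Thm. 6 (§3)] -/
theorem isPsdRect_of_le {r : ℕ} {X E : OddSet n → Matrix (Fin r) (Fin r) ℝ} {Y : PMatch n → Matrix (Fin r) (Fin r) ℝ}
    (hXY : IsPsdRect X Y) (hE : ∀ U, (E U).PosSemidef) (hEX : ∀ U, (X U - E U).PosSemidef) : IsPsdRect E Y := by
  refine ⟨fun U => ⟨hE U, ?_⟩, hXY.2.1, fun U M hUM => ?_⟩
  · have e : 1 - E U = (1 - X U) + (X U - E U) := by abel
    rw [e]; exact (hXY.1 U).2.add (hEX U)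
  · -- `0 = tr(X Y) = tr(E Y) + tr((X − E) Y)`, both terms `≥ 0`
    have h0 : (X U * Y M).trace = 0 := by rw [hXY.2.2 U M hUM, trace_zero]
    have hsplit : (X U * Y M).trace = (E U * Y M).trace + ((X U - E U) * Y M).trace := by
      rw [← trace_add, ← Matrix.add_mul, add_sub_cancel]
    have h1 : 0 ≤ (E U * Y M).trace :=
      (show HasPsdFactorization (fun (_ : Unit) (_ : Unit) => (E U * Y M).trace) r from
        ⟨fun _ => E U, fun _ => Y M, fun _ => hE U, fun _ => (hXY.2.1 M).1, fun _ _ => rfl⟩).nonneg () ()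
    have h2 : 0 ≤ ((X U - E U) * Y M).trace :=
      (show HasPsdFactorization (fun (_ : Unit) (_ : Unit) => ((X U - E U) * Y M).trace) r from
        ⟨fun _ => X U - E U, fun _ => Y M, fun _ => hEX U, fun _ => (hXY.2.1 M).1, fun _ _ => rfl⟩).nonneg () ()
    exact mul_eq_zero_of_posSemidef_trace_eq_zero (hE U) (hXY.2.1 M).1 (by linarith)

/-! ### §2 Dictionary part plus psd remainder -/

/-- A dictionary combination with nonnegative coefficients is psd. -/
theorem posSemidef_dictionary {r : ℕ} {ι : Type*} [Fintype ι] (v : ι → Fin r → ℝ) {lam : ι → ℝ} (hlam : ∀ d, 0 ≤ lam d) :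
    (∑ d, lam d • vecMulVec (v d) (v d)).PosSemidef := by
  refine posSemidef_sum _ fun d _ => ?_
  have h := posSemidef_vecMulVec_self_star (v d)
  rw [star_trivial] at h
  exact h.smul (hlam d)

/-- **Dictionary lemma with a psd remainder.** Let every tight-free 0/1 rectangle have `W`-mass `≤ γ` (`TracialValueLEAt W γ 1`), and let `(X, Y)` be a
tight-orthogonal psd rectangle of dimension `r` with `X_U = D_U + E_U`, `D_U = Σ_{d∈ι} λ_U(d) v_d v_dᵀ` (`0 ≤ λ ≤ 1`, `‖v_d‖ ≤ 1`) and `E_U ⪰ 0`. Then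
`Σ W tr(X_U Y_M) ≤ |ι|·γ + Σ W tr(E_U Y_M)` and `(E, Y)` is again a tight-orthogonal psd rectangle. [cite: Rothvoss2017, §2 (PDF pp. 6–8)] -/
theorem value_le_dictionary_add_remainder {r : ℕ} {ι : Type*} [Fintype ι] (W : OddSet n → PMatch n → ℝ) (γ : ℝ)
    (h1 : TracialValueLEAt W γ 1) (v : ι → Fin r → ℝ) (hv : ∀ d, v d ⬝ᵥ v d ≤ 1)
    (lam : OddSet n → ι → ℝ) (hlam : ∀ U d, 0 ≤ lam U d ∧ lam U d ≤ 1)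
    {X D E : OddSet n → Matrix (Fin r) (Fin r) ℝ} {Y : PMatch n → Matrix (Fin r) (Fin r) ℝ} (hXY : IsPsdRect X Y)
    (hX : ∀ U, X U = D U + E U) (hD : ∀ U, D U = ∑ d, lam U d • vecMulVec (v d) (v d)) (hE : ∀ U, (E U).PosSemidef) :
    ∑ U, ∑ M, W U M * (X U * Y M).trace ≤ Fintype.card ι * γ + ∑ U, ∑ M, W U M * (E U * Y M).trace ∧ IsPsdRect E Y := by
  have hDpsd : ∀ U, (D U).PosSemidef := fun U => by rw [hD U]; exact posSemidef_dictionary v fun d => (hlam U d).1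
  -- tightness splits between `D` and `E`
  have hDt : ∀ U M, cc U M = 1 → (D U * Y M).trace = 0 := fun U M hUM => by
    have h0 : (X U * Y M).trace = 0 := by rw [hXY.2.2 U M hUM, trace_zero]
    rw [hX U, Matrix.add_mul, trace_add] at h0
    have hDn : 0 ≤ (D U * Y M).trace :=
      (show HasPsdFactorization (fun (_ : Unit) (_ : Unit) => (D U * Y M).trace) r from
        ⟨fun _ => D U, fun _ => Y M, fun _ => hDpsd U, fun _ => (hXY.2.1 M).1, fun _ _ => rfl⟩).nonneg () ()
    have hEn : 0 ≤ (E U * Y M).trace :=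
      (show HasPsdFactorization (fun (_ : Unit) (_ : Unit) => (E U * Y M).trace) r from
        ⟨fun _ => E U, fun _ => Y M, fun _ => hE U, fun _ => (hXY.2.1 M).1, fun _ _ => rfl⟩).nonneg () ()
    linarith
  have hEY : IsPsdRect E Y := isPsdRect_of_le hXY hE fun U => by
    have e : X U - E U = D U := by rw [hX U, add_sub_cancel_right]
    rw [e]; exact hDpsd U
  refine ⟨?_, hEY⟩
  have hval := value_le_of_cutDictionary W γ h1 v hv lam hlam D Y hD (fun M => hXY.2.1 M) hDt
  have hsplit : ∑ U, ∑ M, W U M * (X U * Y M).trace =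
      ∑ U, ∑ M, W U M * (D U * Y M).trace + ∑ U, ∑ M, W U M * (E U * Y M).trace := by
    rw [← sum_add_distrib]
    refine sum_congr rfl fun U _ => ?_
    rw [← sum_add_distrib]
    refine sum_congr rfl fun M _ => ?_
    rw [hX U, Matrix.add_mul, trace_add, mul_add]
  rw [hsplit]
  linarith

/-- **Design form: the remainder is junk priced by its trace density.** For a design weight `levelWeight n t C w` and `X = D + E` as above:
`value/r ≤ (|ι|/r)·γ + (Σ_c |w_c|)·τ_E`, `τ_E = (Σ_{|U|=t} tr E_U)/(r·#t-cuts)`. [cite: Rothvoss2017, §2 (PDF pp. 6–8)] -/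
theorem value_div_le_dictionary_add_remainder {t r : ℕ} (hr : 0 < r) {ι : Type*} [Fintype ι] (C : Finset ℕ) (w : ℕ → ℝ) (γ : ℝ)
    (h1 : TracialValueLEAt (levelWeight n t C w) γ 1) (v : ι → Fin r → ℝ) (hv : ∀ d, v d ⬝ᵥ v d ≤ 1)
    (lam : OddSet n → ι → ℝ) (hlam : ∀ U d, 0 ≤ lam U d ∧ lam U d ≤ 1)
    {X D E : OddSet n → Matrix (Fin r) (Fin r) ℝ} {Y : PMatch n → Matrix (Fin r) (Fin r) ℝ} (hXY : IsPsdRect X Y)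
    (hX : ∀ U, X U = D U + E U) (hD : ∀ U, D U = ∑ d, lam U d • vecMulVec (v d) (v d)) (hE : ∀ U, (E U).PosSemidef) :
    (∑ U, ∑ M, levelWeight n t C w U M * (X U * Y M).trace) / r ≤
      Fintype.card ι / r * γ +
        (∑ c ∈ C, |w c|) * ((∑ U ∈ univ.filter (fun U : OddSet n => U.1.card = t), (E U).trace) /
          ((r : ℝ) * (univ.filter (fun U : OddSet n => U.1.card = t)).card)) := by
  have hr' : (0 : ℝ) < r := by exact_mod_cast hr
  obtain ⟨hval, hEY⟩ := value_le_dictionary_add_remainder (levelWeight n t C w) γ h1 v hv lam hlam hXY hX hD hE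
  have hjunk := value_div_le_variation_mul_min (t := t) hr C w hEY
  have hjunk' : (∑ U, ∑ M, levelWeight n t C w U M * (E U * Y M).trace) / r ≤
      (∑ c ∈ C, |w c|) * ((∑ U ∈ univ.filter (fun U : OddSet n => U.1.card = t), (E U).trace) /
        ((r : ℝ) * (univ.filter (fun U : OddSet n => U.1.card = t)).card)) :=
    hjunk.trans (mul_le_mul_of_nonneg_left (min_le_left _ _) (sum_nonneg fun c _ => abs_nonneg _))
  rw [div_le_iff₀ hr'] at hjunk' ⊢
  have e : (Fintype.card ι / r * γ + (∑ c ∈ C, |w c|) * ((∑ U ∈ univ.filter (fun U : OddSet n => U.1.card = t), (E U).trace) /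
      ((r : ℝ) * (univ.filter (fun U : OddSet n => U.1.card = t)).card))) * r =
      Fintype.card ι * γ + (∑ c ∈ C, |w c|) * ((∑ U ∈ univ.filter (fun U : OddSet n => U.1.card = t), (E U).trace) /
        ((r : ℝ) * (univ.filter (fun U : OddSet n => U.1.card = t)).card)) * r := by
    field_simp
  rw [e]
  linarith

/-! ### §3 In the crux's currency, modulo Keevash–Lifshitz Thm 1.8 -/

/-- **Dictionary part plus trace-small junk, modulo KL Thm 1.8.** For some `a > 0` and all large even `n`: for every balanced `B = 20` design of degree
`dq n`, every dimension `r ≥ 1`, every dictionary `ι` and every tight-orthogonal psd rectangle `(X, Y)` with `X = D + E` (`D` dictionary-diagonal over `ι`,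
`E ⪰ 0`): `value/r ≤ (|ι|/r)·exp(−a·dq n) + 20·τ_E`. [cite: KeevashLifshitz2023, Thm. 1.8] [cite: Rothvoss2017, §2 (PDF pp. 6–8)] -/
theorem tracialDecayExp_dictionaryRemainder_of_globalLevelD (hKL : GlobalLevelDInequality) :
    ∃ a : ℝ, 0 < a ∧ ∃ n₁ : ℕ, ∀ n : ℕ, n₁ ≤ n → Even n → ∀ (t : ℕ) (C : Finset ℕ) (w : ℕ → ℝ),
      IsBalancedDesign n t (Tq n) (dq n) 20 C w → ∀ (r : ℕ), 0 < r → ∀ (ι : Type) [Fintype ι],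
        ∀ (v : ι → Fin r → ℝ), (∀ d, v d ⬝ᵥ v d ≤ 1) → ∀ (lam : OddSet n → ι → ℝ), (∀ U d, 0 ≤ lam U d ∧ lam U d ≤ 1) →
        ∀ (X D E : OddSet n → Matrix (Fin r) (Fin r) ℝ) (Y : PMatch n → Matrix (Fin r) (Fin r) ℝ), IsPsdRect X Y →
          (∀ U, X U = D U + E U) → (∀ U, D U = ∑ d, lam U d • vecMulVec (v d) (v d)) → (∀ U, (E U).PosSemidef) →
            (∑ U, ∑ M, levelWeight n t C w U M * (X U * Y M).trace) / r ≤
              Fintype.card ι / r * Real.exp (-(a * (dq n : ℝ))) +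
                20 * ((∑ U ∈ univ.filter (fun U : OddSet n => U.1.card = t), (E U).trace) /
                  ((r : ℝ) * (univ.filter (fun U : OddSet n => U.1.card = t)).card)) := by
  obtain ⟨a, ha, n₁, h⟩ := rectangleDecayExp_of_globalLevelD hKL
  refine ⟨a, ha, n₁, fun n hn hev t C w hdes r hr ι _ v hv lam hlam X D E Y hXY hX hD hE => ?_⟩
  have h1 : TracialValueLEAt (levelWeight n t C w) (Real.exp (-(a * (dq n : ℝ)))) 1 :=
    (tracialValueLEAt_one_iff _ _).2 (h n hn hev t C w hdes)
  have hmain := value_div_le_dictionary_add_remainder hr C w _ h1 v hv lam hlam hXY hX hD hE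
  have hB : ∑ c ∈ C, |w c| ≤ 20 := hdes.1.2.2.2.2.2.2
  have hτ : 0 ≤ (∑ U ∈ univ.filter (fun U : OddSet n => U.1.card = t), (E U).trace) /
      ((r : ℝ) * (univ.filter (fun U : OddSet n => U.1.card = t)).card) :=
    div_nonneg (sum_nonneg fun U _ => (hE U).trace_nonneg) (by positivity)
  exact hmain.trans (by nlinarith)

end Summit.PneNP.PneNP.Theorems.ChebyshevTracialDesignDictionaryRemainder

end
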